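import Summits.HodgeConjecture.HodgeConjecture.Theorems.R90S4EpsWeylFinite               -- ★ p864025 (R90-C131-p05, WEYL-ε): the ε-normaliser membership predicate; brings ★ `R90S4CartanNormMap` (`mul_comm_of_mem_centralizer_of_isRegularElt`, `coe_mem_centralizer_coe_iff`)
import Summits.HodgeConjecture.HodgeConjecture.Theorems.R90S4TwistedNormMapLocal         -- ★ p861787 (K2E3-p27): `epsLoc_eq_self_iff_mem_local` (`ε_v g = g ↔ g ∈ G_v`), `epsLoc_apply_coe`
import Summits.HodgeConjecture.HodgeConjecture.Theorems.R90S4TwistedTransferDefs          -- ★ `IsStablyConjGAt`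
import Summits.HodgeConjecture.HodgeConjecture.Theorems.F0P3cStCharTSWeylCartanRadial     -- ★ `centralizer_eq_of_mem_centralizer_of_isRegularElt` (`Gqs`), for the member corollary
import Summits.HodgeConjecture.HodgeConjecture.Theorems.R90S4SplitFormGL                  -- ★ `splitFormGL` (`(cmDatum L 3 ↑(splitFormGL L)).Local v` IS `Gqs L v`)
import HarnessLib

/-!
# R90-TF · S4 «Ch. 13.1–2», row (W̃ε-VAL) ABSTRACTLY — the ε-twisted Weyl index EQUALS the rational Weyl index at a Cartan whose generating regular element has
# STABLE CLASS = CLASS: `[Ñ^ε_T : T̃] = [N_{G_v}(T) : T]` (Rogawski 1990, §12.5 pp. 182, 186: `W̃^ε_T ≅ Ω_F(T,G) ⊇ Ω(T,G)`, with equality iff `𝔇(T∕F)` meets `T` trivially; §3.6)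

Cell `hodgecm-mathlib`, crux H413 (`stmt-HodgeConjecture-24833`, lane `--supports … --as helper`), route of record `HCCMUnconditional` (no route verbs;
count-neutral).  Programme R90-TF, section S4, dealer K2E2-plan (g7): DEAL 2026-09-05T01:53:46Z (i) «ROW (W̃ε-VAL) FOR TYPE (3) … if you can prove the ABSTRACT form «stable class =
class ⇒ `[Ñ^ε_T : T̃] = [N_{G_v}(T):T]`» WITHOUT coordinates, state it abstractly with type (3) as a corollary» (census 01:56:07Z); seat K2E3-p12 (g10).  Consumers: the `hwF` row of
★ `isTwistedWeylCountT_of_isFinerCount` ∕ ★ `isStableTransportDict_and_isTwistedWeylCountT_of_forall_member` at the CHEAP members (types (0), (3): `wF = w`), K2E3-p31's type-(0) file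
`R90S4SplitCartanEpsWeylIndex` (then `= [N(M):M]`), K2E3-p27's type-(3) cubic rows.

## THE MATHEMATICS (coordinate-free; any `Φ`, any place `v`)
`G_v = U(Φ)(L⁺_v) ⊂ G̃_v = GL₃(L ⊗ L⁺_v)`, `ε = ε_v` (★ `epsLoc`; `ε` fixes `G_v` pointwise and `G_v = {g | ε g = g}`, ★ `epsLoc_apply_coe`, `epsLoc_eq_self_iff_mem_local`); `γ ∈ G_v` REGULAR,
`T := Cent_{G_v}(γ)`, `T̃ := Cent_{G̃_v}(γ)` (abelian, ★ `mul_comm_of_mem_centralizer_of_isRegularElt`; `T̃ ∩ G_v = T`, ★ `coe_mem_centralizer_coe_iff`), `N(T) := N_{G_v}(T)`, and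
`Ñ` the ε-NORMALISER («`m ∈ N_{G̃_v}(T̃) ∧ m ε(m)⁻¹ ∈ T̃`», ★ `R90S4EpsWeylFinite`'s predicate).  (1) `N(T) ⊆ Ñ`: `g ∈ N(T)` conjugates `γ` to a regular `γ′ ∈ T`, and
`Cent_{G̃}(γ′) = T̃` (★ `centralizer_eq_centralizer_of_isRegularElt`), so `g` normalises `T̃`; `g ε(g)⁻¹ = 1`.  (2) the induced map of left-coset spaces `N(T)∕T → Ñ∕T̃` is
INJECTIVE (`T̃ ∩ G_v = T`).  (3) it is SURJECTIVE when the stable class of `γ` is its class: for `m ∈ Ñ`, `t′ := m γ m⁻¹ ∈ T̃` and, with `c := m ε(m)⁻¹ ∈ T̃`,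
`ε(t′) = c⁻¹ t′ c = t′` (`T̃` abelian) — so `t′ ∈ G_v ∩ T̃ = T` is STABLY conjugate to `γ`, hence conjugate: `g γ g⁻¹ = t′` with `g ∈ G_v`; then `g ∈ N(T)` and `g⁻¹ m ∈ Cent(γ) = T̃`,
i.e. `m ∈ g T̃`.  Hence `[Ñ : T̃] = [N(T) : T]` (`Subgroup.index_eq_card` + the bijection).

## CONTENTS
* §1 `conj_mem_centralizer_singleton_conj_iff` (group lemma), `val_mem_epsNormalizer_of_mem_normalizer` ((1): `N_{G_v}(T) ⊆ Ñ^ε_T`).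
* §2 **`index_epsNormalizer_eq_index_normalizer_of_stable_eq_class`** — THE HEAD (any `Φ`, one regular `γ` with «`∀ γ′, γ ∼_{st} γ′ → γ ∼ γ′`»).
* §3 **`index_epsNormalizer_eq_weylIndex_member_of_stable_eq_class`** — member form in the `Gqs`∕`splitFormGL` currency of the `hwF` row: for `T_i = Cent(γ₀) ∈ C` with stable class =
  class on `T_i^{reg}` and any regular `t_k ∈ T_i`, `[Ñ^ε : Cent_{G̃}(t_k)] = [N(T_i) : T_i]` — i.e. `hwF` holds with `wF i := [N(T_i):T_i]` at every cheap member (types (0) via ★ p863493,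
  (3) via the cubic criterion).

HONEST LABEL: HC_CM is proved only modulo the 7 printed citations (2 remaining named inputs: hLiu418 = stmt-HodgeConjecture-24832, h413 = stmt-HodgeConjecture-24833) until rung 0
closes.  Group algebra; supplies the (W̃ε-VAL) row at the cheap Cartan types only (types (1)(2) need their own counts); (B1), (W-NP) OPEN.  REL ≠ ★ ≠ BUILT.
Theorems only; no instance, no notation, no `sorry`.

## References
* [Rogawski1990] J. D. Rogawski, *Automorphic Representations of Unitary Groups in Three Variables*, Ann. of Math. Stud. 123 (1990), §12.5 pp. 182, 186; §3.6 pp. 28–31; §3.5 p. 28;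
  §3.10–3.11 pp. 33–35.
-/

set_option autoImplicit false
set_option linter.dupNamespace false

noncomputable section

open NumberField IsDedekindDomain
open scoped Matrix MatrixGroups
open Literature.NumberTheory.Automorphic Literature.NumberTheory.Automorphic.UnitaryGroup
open Literature.NumberTheory.Rogawski1990 Literature.NumberTheory.Rogawski1990.Ch4Sec10
open Summit.HodgeConjecture.HodgeConjecture.Cruxes.H413

namespace Summit.HodgeConjecture.HodgeConjecture.R90.S4

section EpsWeylIndex

variable (L : Type) [Field L] [NumberField L] [IsCMField L] (Φ : GL (Fin 3) L) (v : HeightOneSpectrum (𝓞 ↥(maximalRealSubfield L)))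

/-! ## §1 Plumbing -/

/-- Group lemma: `n` commutes with `a` iff `g n g⁻¹` commutes with `g a g⁻¹`. [cite: Rogawski1990, §3.1 p. 19] -/
theorem conj_mem_centralizer_singleton_conj_iff {G : Type} [Group G] (g a n : G) :
    g * n * g⁻¹ ∈ Subgroup.centralizer ({g * a * g⁻¹} : Set G) ↔ n ∈ Subgroup.centralizer ({a} : Set G) := by
  rw [Subgroup.mem_centralizer_singleton_iff, Subgroup.mem_centralizer_singleton_iff]
  constructor
  · intro h
    calc n * a = g⁻¹ * (g * n * g⁻¹ * (g * a * g⁻¹)) * g := by group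
      _ = g⁻¹ * (g * a * g⁻¹ * (g * n * g⁻¹)) * g := by rw [h]
      _ = a * n := by group
  · intro h
    calc g * n * g⁻¹ * (g * a * g⁻¹) = g * (n * a) * g⁻¹ := by group
      _ = g * (a * n) * g⁻¹ := by rw [h]
      _ = g * a * g⁻¹ * (g * n * g⁻¹) := by group

variable {L Φ v} in
/-- **`N_{G_v}(T) ⊆ Ñ^ε_T`** (`γ` regular, `T = Cent_{G_v}(γ)`, `T̃ = Cent_{G̃_v}(γ)`): an element of `G_v` normalising `T` normalises `T̃` (it conjugates `γ` to a regular `γ′ ∈ T ⊆ T̃`, and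
`Cent_{G̃}(γ′) = T̃`, ★ `centralizer_eq_centralizer_of_isRegularElt`) and satisfies `g ε(g)⁻¹ = 1 ∈ T̃` (★ `epsLoc_apply_coe`). [cite: Rogawski1990, §12.5 p. 186] -/
theorem val_mem_epsNormalizer_of_mem_normalizer {γ : (UnitaryGroup.cmDatum L 3 (Φ : Matrix (Fin 3) (Fin 3) L)).Local v} (hγ : IsRegularElt (γ.val : GtLoc L v))
    (N' : Subgroup (GtLoc L v))
    (hN' : ∀ m : GtLoc L v, m ∈ N' ↔
      m ∈ Subgroup.normalizer ((Subgroup.centralizer ({(γ.val : GtLoc L v)} : Set (GtLoc L v)) : Subgroup (GtLoc L v)) : Set (GtLoc L v)) ∧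
        m * (epsLoc L Φ v m)⁻¹ ∈ Subgroup.centralizer ({(γ.val : GtLoc L v)} : Set (GtLoc L v)))
    {g : (UnitaryGroup.cmDatum L 3 (Φ : Matrix (Fin 3) (Fin 3) L)).Local v}
    (hg : g ∈ Subgroup.normalizer ((Subgroup.centralizer ({γ} : Set ((UnitaryGroup.cmDatum L 3 (Φ : Matrix (Fin 3) (Fin 3) L)).Local v)) :
      Subgroup ((UnitaryGroup.cmDatum L 3 (Φ : Matrix (Fin 3) (Fin 3) L)).Local v)) : Set ((UnitaryGroup.cmDatum L 3 (Φ : Matrix (Fin 3) (Fin 3) L)).Local v))) :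
    (g.val : GtLoc L v) ∈ N' := by
  refine (hN' _).mpr ⟨?_, ?_⟩
  · -- `g γ g⁻¹ ∈ T` is regular with the same centraliser `T̃`
    have hγT : γ ∈ Subgroup.centralizer ({γ} : Set ((UnitaryGroup.cmDatum L 3 (Φ : Matrix (Fin 3) (Fin 3) L)).Local v)) :=
      Subgroup.mem_centralizer_singleton_iff.mpr rfl
    have hγ' : g * γ * g⁻¹ ∈ Subgroup.centralizer ({γ} : Set ((UnitaryGroup.cmDatum L 3 (Φ : Matrix (Fin 3) (Fin 3) L)).Local v)) :=
      (Subgroup.mem_normalizer_iff.mp hg γ).mp hγT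
    have hγ'v : ((g * γ * g⁻¹ : (UnitaryGroup.cmDatum L 3 (Φ : Matrix (Fin 3) (Fin 3) L)).Local v).val : GtLoc L v) = g.val * γ.val * (g.val)⁻¹ := rfl
    have hreg' : IsRegularElt (((g * γ * g⁻¹ : (UnitaryGroup.cmDatum L 3 (Φ : Matrix (Fin 3) (Fin 3) L)).Local v).val : GtLoc L v)) := by
      rw [hγ'v]
      exact (isRegularElt_conj_iff (g.val : GtLoc L v) γ.val).mpr hγ
    have hcent : Subgroup.centralizer ({(g.val * γ.val * (g.val)⁻¹ : GtLoc L v)} : Set (GtLoc L v)) =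
        Subgroup.centralizer ({(γ.val : GtLoc L v)} : Set (GtLoc L v)) := by
      rw [← hγ'v]
      exact centralizer_eq_centralizer_of_isRegularElt hγ hreg' ((coe_mem_centralizer_coe_iff γ _).mpr hγ')
    refine Subgroup.mem_normalizer_iff.mpr fun n => ⟨fun hn => ?_, fun hn => ?_⟩
    · rw [← hcent]
      exact (conj_mem_centralizer_singleton_conj_iff _ _ n).mpr hn
    · rw [← hcent] at hn
      exact (conj_mem_centralizer_singleton_conj_iff _ _ n).mp hn
  · rw [epsLoc_apply_coe, mul_inv_cancel]
    exact Subgroup.one_mem _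

/-! ## §2 The head: `[Ñ^ε_T : T̃] = [N_{G_v}(T) : T]` when the stable class of `γ` is its class -/

set_option maxHeartbeats 400000 in
variable {L Φ v} in
/-- **THE ε-TWISTED WEYL INDEX EQUALS THE RATIONAL WEYL INDEX when the stable class of the regular generator is its conjugacy class** (any `Φ`, any `v`): for `γ ∈ G_v` regular with
`∀ γ′, γ ∼_{st} γ′ → γ ∼ γ′`, `T = Cent_{G_v}(γ)`, `T̃ = Cent_{G̃_v}(γ)` and `Ñ` any subgroup with the ε-normaliser predicate (★ `R90S4EpsWeylFinite`):
`[Ñ : T̃] = [N_{G_v}(T) : T]` — the left-coset map `N(T)∕T → Ñ∕T̃` induced by `G_v ⊂ G̃_v` is injective (`T̃ ∩ G_v = T`) and surjective (for `m ∈ Ñ`, `m γ m⁻¹ ∈ T̃` is ε-fixed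
because `m ε(m)⁻¹ ∈ T̃` and `T̃` is abelian, hence lies in `T`, stably hence rationally conjugate to `γ`, and the conjugator `g ∈ N(T)` has `m ∈ g T̃`).
[cite: Rogawski1990, §12.5 pp. 182, 186; §3.6 pp. 28–31] -/
theorem index_epsNormalizer_eq_index_normalizer_of_stable_eq_class
    {γ : (UnitaryGroup.cmDatum L 3 (Φ : Matrix (Fin 3) (Fin 3) L)).Local v} (hγ : IsRegularElt (γ.val : GtLoc L v))
    (hst : ∀ γ' : (UnitaryGroup.cmDatum L 3 (Φ : Matrix (Fin 3) (Fin 3) L)).Local v, IsStablyConjGAt L Φ v γ γ' → IsConj γ γ')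
    (N' : Subgroup (GtLoc L v))
    (hN' : ∀ m : GtLoc L v, m ∈ N' ↔
      m ∈ Subgroup.normalizer ((Subgroup.centralizer ({(γ.val : GtLoc L v)} : Set (GtLoc L v)) : Subgroup (GtLoc L v)) : Set (GtLoc L v)) ∧
        m * (epsLoc L Φ v m)⁻¹ ∈ Subgroup.centralizer ({(γ.val : GtLoc L v)} : Set (GtLoc L v))) :
    ((Subgroup.centralizer ({(γ.val : GtLoc L v)} : Set (GtLoc L v))).subgroupOf N').index =
      ((Subgroup.centralizer ({γ} : Set ((UnitaryGroup.cmDatum L 3 (Φ : Matrix (Fin 3) (Fin 3) L)).Local v))).subgroupOf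
        (Subgroup.normalizer ((Subgroup.centralizer ({γ} : Set ((UnitaryGroup.cmDatum L 3 (Φ : Matrix (Fin 3) (Fin 3) L)).Local v)) :
          Subgroup ((UnitaryGroup.cmDatum L 3 (Φ : Matrix (Fin 3) (Fin 3) L)).Local v)) : Set ((UnitaryGroup.cmDatum L 3 (Φ : Matrix (Fin 3) (Fin 3) L)).Local v)))).index := by
  classical
  -- notation
  set T : Subgroup ((UnitaryGroup.cmDatum L 3 (Φ : Matrix (Fin 3) (Fin 3) L)).Local v) :=
    Subgroup.centralizer ({γ} : Set ((UnitaryGroup.cmDatum L 3 (Φ : Matrix (Fin 3) (Fin 3) L)).Local v)) with hTdef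
  set NT : Subgroup ((UnitaryGroup.cmDatum L 3 (Φ : Matrix (Fin 3) (Fin 3) L)).Local v) :=
    Subgroup.normalizer ((T : Subgroup ((UnitaryGroup.cmDatum L 3 (Φ : Matrix (Fin 3) (Fin 3) L)).Local v)) :
      Set ((UnitaryGroup.cmDatum L 3 (Φ : Matrix (Fin 3) (Fin 3) L)).Local v)) with hNTdef
  set Tt : Subgroup (GtLoc L v) := Subgroup.centralizer ({(γ.val : GtLoc L v)} : Set (GtLoc L v)) with hTtdef
  have hcomm : ∀ a ∈ Tt, ∀ b ∈ Tt, a * b = b * a := fun a ha b hb => mul_comm_of_mem_centralizer_of_isRegularElt hγ ha hb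
  -- the map `NT → N'` and the induced map on left cosets
  have hmemN' : ∀ g : ↥NT, ((g : (UnitaryGroup.cmDatum L 3 (Φ : Matrix (Fin 3) (Fin 3) L)).Local v).val : GtLoc L v) ∈ N' :=
    fun g => val_mem_epsNormalizer_of_mem_normalizer hγ N' hN' g.2
  let φ : ↥NT → ↥N' := fun g => ⟨((g : (UnitaryGroup.cmDatum L 3 (Φ : Matrix (Fin 3) (Fin 3) L)).Local v).val : GtLoc L v), hmemN' g⟩
  have hφmul : ∀ a b : ↥NT, φ (a⁻¹ * b) = (φ a)⁻¹ * φ b := fun a b => rfl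
  -- `T̃ ∩ G_v = T`, read on `NT`: `a⁻¹ b ∈ T ↔ φ(a⁻¹ b) ∈ T̃`
  have hker : ∀ a b : ↥NT, (φ a)⁻¹ * φ b ∈ Tt.subgroupOf N' ↔ a⁻¹ * b ∈ T.subgroupOf NT := by
    intro a b
    rw [← hφmul, Subgroup.mem_subgroupOf, Subgroup.mem_subgroupOf]
    exact coe_mem_centralizer_coe_iff γ _
  let ψ : (↥NT ⧸ T.subgroupOf NT) → (↥N' ⧸ Tt.subgroupOf N') :=
    Quotient.lift (fun g : ↥NT => (QuotientGroup.mk (φ g) : ↥N' ⧸ Tt.subgroupOf N')) fun a b hab =>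
      QuotientGroup.eq.mpr ((hker a b).mpr (QuotientGroup.leftRel_apply.mp hab))
  have hψmk : ∀ g : ↥NT, ψ (QuotientGroup.mk g) = QuotientGroup.mk (φ g) := fun _ => rfl
  -- ψ is a bijection
  have hinj : Function.Injective ψ := by
    intro x y hxy
    induction x using QuotientGroup.induction_on with
    | H a =>
      induction y using QuotientGroup.induction_on with
      | H b =>
        rw [hψmk, hψmk] at hxy
        exact QuotientGroup.eq.mpr ((hker a b).mp (QuotientGroup.eq.mp hxy))
  have hsurj : Function.Surjective ψ := by
    intro y
    induction y using QuotientGroup.induction_on with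
    | H m =>
      obtain ⟨hmN, hmc⟩ := (hN' _).mp m.2
      -- `t′ := m γ m⁻¹ ∈ T̃`, ε-fixed, hence in `G_v`
      have hγTt : (γ.val : GtLoc L v) ∈ Tt := Subgroup.mem_centralizer_singleton_iff.mpr rfl
      have ht'Tt : (m : GtLoc L v) * γ.val * (m : GtLoc L v)⁻¹ ∈ Tt := (Subgroup.mem_normalizer_iff.mp hmN _).mp hγTt
      have hεm : epsLoc L Φ v (m : GtLoc L v) = ((m : GtLoc L v) * (epsLoc L Φ v (m : GtLoc L v))⁻¹)⁻¹ * (m : GtLoc L v) := by group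
      have hfix : epsLoc L Φ v ((m : GtLoc L v) * γ.val * (m : GtLoc L v)⁻¹) = (m : GtLoc L v) * γ.val * (m : GtLoc L v)⁻¹ := by
        have hc := hcomm _ (Tt.inv_mem hmc) _ ht'Tt
        rw [map_mul, map_mul, map_inv, epsLoc_apply_coe, hεm]
        calc ((m : GtLoc L v) * (epsLoc L Φ v (m : GtLoc L v))⁻¹)⁻¹ * (m : GtLoc L v) * γ.val *
              (((m : GtLoc L v) * (epsLoc L Φ v (m : GtLoc L v))⁻¹)⁻¹ * (m : GtLoc L v))⁻¹
            = ((m : GtLoc L v) * (epsLoc L Φ v (m : GtLoc L v))⁻¹)⁻¹ * ((m : GtLoc L v) * γ.val * (m : GtLoc L v)⁻¹) *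
              ((m : GtLoc L v) * (epsLoc L Φ v (m : GtLoc L v))⁻¹) := by group
          _ = (m : GtLoc L v) * γ.val * (m : GtLoc L v)⁻¹ * ((m : GtLoc L v) * (epsLoc L Φ v (m : GtLoc L v))⁻¹)⁻¹ *
              ((m : GtLoc L v) * (epsLoc L Φ v (m : GtLoc L v))⁻¹) := by rw [hc]
          _ = (m : GtLoc L v) * γ.val * (m : GtLoc L v)⁻¹ := by group
      have ht'U : (m : GtLoc L v) * γ.val * (m : GtLoc L v)⁻¹ ∈ UnitaryGroup.local L (IsCMField.complexConj L) 3 (Φ : Matrix (Fin 3) (Fin 3) L) v :=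
        (epsLoc_eq_self_iff_mem_local L Φ v _).mp hfix
      set γ' : (UnitaryGroup.cmDatum L 3 (Φ : Matrix (Fin 3) (Fin 3) L)).Local v := ⟨(m : GtLoc L v) * γ.val * (m : GtLoc L v)⁻¹, ht'U⟩ with hγ'def
      have hγ'v : (γ'.val : GtLoc L v) = (m : GtLoc L v) * γ.val * (m : GtLoc L v)⁻¹ := rfl
      -- `γ′` is stably conjugate to `γ`, hence conjugate: `g γ g⁻¹ = γ′`
      have hst' : IsStablyConjGAt L Φ v γ γ' := isConj_iff.mpr ⟨(m : GtLoc L v), hγ'v.symm⟩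
      obtain ⟨g, hg⟩ := isConj_iff.mp (hst γ' hst')
      -- `g ∈ N_{G_v}(T)`
      have hγ'T : γ' ∈ T := (coe_mem_centralizer_coe_iff γ γ').mp (hγ'v ▸ ht'Tt)
      have hγ'reg : IsRegularElt (γ'.val : GtLoc L v) := by
        rw [hγ'v]
        exact (isRegularElt_conj_iff (m : GtLoc L v) γ.val).mpr hγ
      have hcentK : Subgroup.centralizer ({γ'} : Set ((UnitaryGroup.cmDatum L 3 (Φ : Matrix (Fin 3) (Fin 3) L)).Local v)) = T := by
        ext n
        rw [← coe_mem_centralizer_coe_iff γ' n, ← coe_mem_centralizer_coe_iff γ n,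
          centralizer_eq_centralizer_of_isRegularElt hγ hγ'reg ((coe_mem_centralizer_coe_iff γ γ').mpr hγ'T)]
      have hgNT : g ∈ NT := by
        refine Subgroup.mem_normalizer_iff.mpr fun n => ⟨fun hn => ?_, fun hn => ?_⟩
        · rw [← hcentK, ← hg]
          exact (conj_mem_centralizer_singleton_conj_iff _ _ n).mpr hn
        · rw [← hcentK, ← hg] at hn
          exact (conj_mem_centralizer_singleton_conj_iff _ _ n).mp hn
      refine ⟨QuotientGroup.mk ⟨g, hgNT⟩, ?_⟩
      rw [hψmk]
      refine QuotientGroup.eq.mpr (Subgroup.mem_subgroupOf.mpr ?_)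
      -- `g⁻¹ m ∈ Cent(γ)`: `(g⁻¹ m) γ (g⁻¹ m)⁻¹ = g⁻¹ γ′ g = γ`
      show ((g.val : GtLoc L v))⁻¹ * (m : GtLoc L v) ∈ Tt
      have hgv : (g.val : GtLoc L v) * γ.val * (g.val : GtLoc L v)⁻¹ = γ'.val := by
        rw [← hg]; rfl
      rw [hTtdef, Subgroup.mem_centralizer_singleton_iff]
      calc (g.val : GtLoc L v)⁻¹ * (m : GtLoc L v) * γ.val
          = (g.val : GtLoc L v)⁻¹ * ((m : GtLoc L v) * γ.val * (m : GtLoc L v)⁻¹) * (m : GtLoc L v) := by group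
        _ = (g.val : GtLoc L v)⁻¹ * ((g.val : GtLoc L v) * γ.val * (g.val : GtLoc L v)⁻¹) * (m : GtLoc L v) := by rw [← hγ'v, ← hgv]
        _ = γ.val * ((g.val : GtLoc L v)⁻¹ * (m : GtLoc L v)) := by group
  rw [Subgroup.index_eq_card, Subgroup.index_eq_card]
  exact (Nat.card_congr (Equiv.ofBijective ψ ⟨hinj, hsurj⟩)).symm

/-! ## §3 Member form, in the currency of the `hwF` row -/

variable {L v} in
/-- **(W̃ε-VAL) AT A CHEAP MEMBER** (`Φ₃ = splitFormGL`, `Gqs` currency of the `hwF` row of ★ `isTwistedWeylCountT_of_isFinerCount`): for a member `T_i = Cent(γ₀) ∈ C` on whose regular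
points stable class = class, every regular `t_k ∈ T_i` and every `Ñ` with the ε-normaliser predicate at `Cent_{G̃_v}(t_k)`: `[Ñ : Cent_{G̃_v}(t_k)] = [N(T_i) : T_i]` — so the row holds with
`wF i := [N(T_i):T_i]` (types (0) via ★ p863493, (3) via the cubic criterion). [cite: Rogawski1990, §12.5 pp. 182, 186; §3.6 pp. 28–31] -/
theorem index_epsNormalizer_eq_weylIndex_member_of_stable_eq_class {C : Finset (Subgroup (Gqs L v))}
    (hZ : ∀ T ∈ C, ∃ γ₀ : Gqs L v, IsRegularElt (γ₀.val : GL (Fin 3) (LocalRing L v)) ∧ T = Subgroup.centralizer ({γ₀} : Set (Gqs L v)))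
    (i : ↥C)
    (hT : ∀ t : ↥(i : Subgroup (Gqs L v)), IsRegularElt (((t : Gqs L v)).val : GL (Fin 3) (LocalRing L v)) →
      ∀ γ' : Gqs L v, IsStablyConjGAt L (R90.S4.splitFormGL L) v (t : Gqs L v) γ' → IsConj (t : Gqs L v) γ')
    (tk : ↥(i : Subgroup (Gqs L v))) (htk : IsRegularElt (((tk : Gqs L v)).val : GL (Fin 3) (LocalRing L v)))
    (N' : Subgroup (GtLoc L v))
    (hN' : ∀ m : GtLoc L v, m ∈ N' ↔
      m ∈ Subgroup.normalizer ((Subgroup.centralizer ({((tk : Gqs L v).val : GtLoc L v)} : Set (GtLoc L v)) : Subgroup (GtLoc L v)) : Set (GtLoc L v)) ∧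
        m * (epsLoc L (R90.S4.splitFormGL L) v m)⁻¹ ∈ Subgroup.centralizer ({((tk : Gqs L v).val : GtLoc L v)} : Set (GtLoc L v))) :
    ((Subgroup.centralizer ({((tk : Gqs L v).val : GtLoc L v)} : Set (GtLoc L v))).subgroupOf N').index =
      ((i : Subgroup (Gqs L v)).subgroupOf (Subgroup.normalizer ((i : Subgroup (Gqs L v)) : Set (Gqs L v)))).index := by
  obtain ⟨γ₀, hγ₀, hTeq⟩ := hZ i i.2
  have hi : (i : Subgroup (Gqs L v)) = Subgroup.centralizer ({(tk : Gqs L v)} : Set (Gqs L v)) :=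
    hTeq.trans (F0P3cStCharTSWeylCartanRadial.centralizer_eq_of_mem_centralizer_of_isRegularElt L v hγ₀ (hTeq.le tk.2) htk).symm
  have hidx : ((i : Subgroup (Gqs L v)).subgroupOf (Subgroup.normalizer ((i : Subgroup (Gqs L v)) : Set (Gqs L v)))).index =
      ((Subgroup.centralizer ({(tk : Gqs L v)} : Set (Gqs L v))).subgroupOf
        (Subgroup.normalizer ((Subgroup.centralizer ({(tk : Gqs L v)} : Set (Gqs L v)) : Subgroup (Gqs L v)) : Set (Gqs L v)))).index :=
    congrArg (fun S : Subgroup (Gqs L v) => (S.subgroupOf (Subgroup.normalizer (S : Set (Gqs L v)))).index) hi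
  rw [hidx]
  exact index_epsNormalizer_eq_index_normalizer_of_stable_eq_class (Φ := R90.S4.splitFormGL L) htk (hT tk htk) N' hN'

end EpsWeylIndex

end Summit.HodgeConjecture.HodgeConjecture.R90.S4

end
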